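import Summits.Ventures.YMGap.RobustBall.MassGapOnBallZdW
import HarnessLib

/-!
# Venture YMGap, track ROBUST-BALL (Y2) — crux «Y2-X2-P», STEP 1: THE STATEMENT of the TIER-3 (POWER-LAW) `ℤ^d` ball —
# `MemBallZdP p ε₀ ε₁`, the member target `PerturbedPolyClusteringAt`, the ball target `PolyClusteringOnBallZd`

HONEST FRAMING. WHAT THIS IS: a venture DEFINITIONS file (cell `pub-ymgap`, track Y2 ROBUST-BALL, seat ds-2 (g14); lead R390 (A)/(B) STEP 1;
currency of record = rb-theory g23 l.7796 (2) (i)–(iii), adopted by the chair). It fixes TYPES only; nothing is asserted: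
* `MemBallZdP p ε₀ ε₁ W` — MEMBERSHIP in the tier-3 `ℤ^d` ball: the fields of the tier-2 ball `MemBallZdW κ ε₀ ε₁ W`
  (`MassGapOnBallZdW.lean`) VERBATIM with the exponential diameter weight `e^{κ·diam X}` replaced by the POLYNOMIAL weight
  `(1 + diam X)^p` (`p : ℝ` a parameter, real power `Real.rpow`): continuous gauge-invariant own-link terms, a summable link majorant,
  oscillation witnesses with `Σ'_{X ∋ e} (1 + diam X)^p osc_X(e) ≤ ε₀` at every link and Frobenius-Lipschitz witnesses with the
  SITE-incidence load `Σ'_{X based at v} (1 + diam X)^p Σ_{y ∈ X} lip_X(y) ≤ ε₁` at every site;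
* `PerturbedPolyClusteringAt d N β p′ W` — THE MEMBER TARGET ('t Hooft coupling `β`): `PerturbedMassGapAtS d N β W` VERBATIM with the rate factor
  `e^{−c·dist(Λ₁,Λ₂)}` (`∃ c > 0`) replaced by `(1 + dist(Λ₁,Λ₂))^{−p′}` at the given exponent (real power `Real.rpow`): exactly one DLR state of
  `perturbedYMS (fundamentalRep (Fin N)) (N β) W`, and for every DLR state `μ` and support size `n` a constant `c₁` with
  `|cov_μ(F₁,F₂)| ≤ c₁ (1 + dist(Λ₁,Λ₂))^{−p′} (K₁K₂ + ‖F₁‖₂‖F₂‖₂)` for Lipschitz cylinder observables on disjoint link sets of size `≤ n` —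
  POWER-LAW clustering of exponent `p′` with the support dependence carried by `n ↦ c₁` exactly as in the tier-2 target, so that
  «tier 2 ⇒ tier 3 for every `p′`» on common members is one line (STEP 2); the shifted reading `|cov_μ(F, G ∘ τ_x)| ≤ C_{F,G}(1+‖x‖)^{−p′}`
  is a corollary with a support-dependent constant (it cannot hold with a support-free one: shift `G` back onto `F`);
* `PolyClusteringOnBallZd d N β p p′ ε₀ ε₁` — THE BALL TARGET: every member of `MemBallZdP p ε₀ ε₁` has `PerturbedPolyClusteringAt d N β p′`.
  The relation `p′ < p` is carried by the door THEOREMS (STEP 3), never by the definition.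
Trivial API only: monotonicity in the loads, the centre `W = 0` (Wilson) is a member, and `.wilson`.
WHAT THIS IS NOT: no door, no number, no row; power-law clustering is WEAKER than a mass gap and is what power-law interactions allow —
the words «mass gap» are not used for tier 3; strong-coupling LATTICE bookkeeping; nothing about the continuum or the Millennium problem.
-/

noncomputable section

open MeasureTheory Function Finset ProbabilityTheory
open scoped NNReal
open Literature.Probability.LatticeModels
open Literature.Probability.LatticeModels.DobrushinMetric
open Literature.MathematicalPhysics.QuantumLattice
open Literature.MathematicalPhysics.QuantumFieldTheory hiding ZdEdge
open Summit.Ventures.YMGap.DSWindowZd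

namespace Summit.Ventures.YMGap.RobustBall

variable {d N : ℕ}

/-! ### The tier-3 (polynomially weighted) gauge-invariant ball -/

/-- **Membership in the tier-3 gauge-invariant `ℤ^d` ball** of polynomial weight exponent `p` and loads `(ε₀, ε₁)`: the fields of
`MemBallZdW` with the weight `e^{κ·diam X}` replaced by `(1 + diam X)^p` — continuous gauge-invariant terms depending on their own links,
a summable link majorant, oscillation witnesses with `Σ'_{X ∋ e} (1 + diam X)^p osc_X(e) ≤ ε₀` at every link `e`, and Frobenius-Lipschitz
witnesses with the SITE-incidence load `Σ'_{X based at v} (1 + diam X)^p Σ_{y ∈ X} lip_X(y) ≤ ε₁` at every site `v`. [folklore] -/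
structure MemBallZdP (p ε₀ ε₁ : ℝ) (W : Potential (ZdEdge d) (SUN N)) : Prop where
  /-- every term is continuous -/
  continuous : ∀ X, Continuous (W X)
  /-- every term depends only on the links of its set -/
  dependsOn : ∀ X, DependsOn (W X) (↑X : Set (ZdEdge d))
  /-- every term is gauge invariant -/
  gaugeInvariant : ∀ X, IsZdGaugeInvariant (W X)
  /-- a summable link majorant -/
  summable : ∃ B, IsLinkSummable W B
  /-- the polynomially weighted loads -/
  loads : ∃ osc lip : Finset (ZdEdge d) → ZdEdge d → ℝ,
    (∀ X, Dobrushin.IsOscBound (W X) (osc X)) ∧ (∀ X, IsLipBound suFrobDist (W X) (lip X)) ∧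
      (∀ e, Summable fun X : Finset (ZdEdge d) =>
        (if e ∈ X then (1 + (linkDiamZd X : ℝ)) ^ p * osc X e else 0)) ∧
      (∀ e, ∑' X : Finset (ZdEdge d),
        (if e ∈ X then (1 + (linkDiamZd X : ℝ)) ^ p * osc X e else 0) ≤ ε₀) ∧
      (∀ v : Site d, Summable fun X : Finset (ZdEdge d) =>
        (if (∃ μ : Fin d, ((v, μ) : ZdEdge d) ∈ X) then (1 + (linkDiamZd X : ℝ)) ^ p * ∑ y ∈ X, lip X y else 0)) ∧
      (∀ v : Site d, ∑' X : Finset (ZdEdge d),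
        (if (∃ μ : Fin d, ((v, μ) : ZdEdge d) ∈ X) then (1 + (linkDiamZd X : ℝ)) ^ p * ∑ y ∈ X, lip X y else 0)
          ≤ ε₁)

/-- The tier-3 ball is monotone in its loads. [folklore] -/
theorem MemBallZdP.mono {p ε₀ ε₁ ε₀' ε₁' : ℝ} {W : Potential (ZdEdge d) (SUN N)} (h : MemBallZdP p ε₀ ε₁ W)
    (h₀ : ε₀ ≤ ε₀') (h₁ : ε₁ ≤ ε₁') : MemBallZdP p ε₀' ε₁' W := by
  obtain ⟨osc, lip, h1, h2, h3, h4, h5, h6⟩ := h.loads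
  exact ⟨h.continuous, h.dependsOn, h.gaugeInvariant, h.summable, osc, lip, h1, h2, h3,
    fun e => (h4 e).trans h₀, h5, fun v => (h6 v).trans h₁⟩

/-- The zero potential (the centre: Wilson) is a member of every tier-3 ball with nonnegative loads. [folklore] -/
theorem memBallZdP_zero {p ε₀ ε₁ : ℝ} (h₀ : 0 ≤ ε₀) (h₁ : 0 ≤ ε₁) : MemBallZdP (d := d) (N := N) p ε₀ ε₁ 0 where
  continuous _ := continuous_const
  dependsOn _ _ _ _ := rfl
  gaugeInvariant _ _ _ := rfl
  summable := ⟨fun _ => 0, fun _ _ => by simp, fun _ => by simp⟩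
  loads := ⟨fun _ _ => 0, fun _ _ => 0, fun _ => ⟨fun _ => le_rfl, fun _ _ _ _ => by simp⟩,
    fun _ => ⟨fun _ => le_rfl, fun _ _ _ _ => by simp⟩, fun _ => by simp, fun _ => by simpa using h₀,
    fun _ => by simp, fun _ => by simpa using h₁⟩

/-! ### The member target: exactly one DLR state and power-law clustering of exponent `p′` -/

variable (d N) in
/-- **Power-law clustering of a summable member** `N β S_W + W` on `ℤ^d` ('t Hooft coupling `β`) with exponent `p′`: the member target
`PerturbedMassGapAtS d N β W` (`MassGapOnBallS.lean`) VERBATIM with its rate factor `e^{−c·dist(Λ₁,Λ₂)}` (`∃ c > 0`) replaced by the power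
`(1 + dist(Λ₁,Λ₂))^{−p′}` at the GIVEN exponent `p′` — (i) exactly one DLR state of `perturbedYMS (fundamentalRep (Fin N)) (N β) W`;
(ii) for every DLR state `μ` and every support size `n` a constant `c₁` with
`|cov_μ(F₁, F₂)| ≤ c₁ (1 + dist(Λ₁, Λ₂))^{−p′} (K₁ K₂ + ‖F₁‖₂ ‖F₂‖₂)` for Lipschitz cylinder observables on disjoint link sets of size `≤ n`
(`dist` = `setDistEdges`; the support dependence is carried by `n ↦ c₁` exactly as in `PerturbedMassGapAtS`, which makes «tier 2 ⇒ tier 3 for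
every `p′`» a one-line comparison `e^{−c x} ≤ max(1, p′/c)^{p′} (1 + x)^{−p′}`). Weaker than a mass gap. [folklore] -/
def PerturbedPolyClusteringAt (β p' : ℝ) (W : Potential (ZdEdge d) (SUN N)) : Prop :=
  HasUniqueGibbsMeasure (perturbedYMS (d := d) (fundamentalRep (Fin N)) (N * β) W) ∧
    ∀ μ ∈ perturbedGibbsMeasuresS (d := d) (fundamentalRep (Fin N)) (N * β) W,
      ∀ n : ℕ, ∃ c₁ : ℝ,
        ∀ (F₁ F₂ : LGConfig d (SUN N) → ℝ) (Λ₁ Λ₂ : Finset (ZdEdge d)) (K₁ K₂ : ℝ≥0),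
          Λ₁.card ≤ n → Λ₂.card ≤ n → Disjoint Λ₁ Λ₂ →
          IsLipschitzCylinder (fundamentalRep (Fin N)) F₁ Λ₁ K₁ →
          IsLipschitzCylinder (fundamentalRep (Fin N)) F₂ Λ₂ K₂ →
            |cov[F₁, F₂; μ]| ≤ c₁ * (1 + setDistEdges Λ₁ Λ₂) ^ (-p') *
              ((K₁ : ℝ) * K₂ + Real.sqrt (∫ U, F₁ U ^ 2 ∂μ) * Real.sqrt (∫ U, F₂ U ^ 2 ∂μ))

variable (d N) in
/-- **THE TIER-3 `ℤ^d` TARGET TYPE — power-law clustering uniformly on the gauge-invariant polynomially weighted ball**: every member of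
`MemBallZdP p ε₀ ε₁` has `PerturbedPolyClusteringAt d N β p′`. The relation between `p′` and `p` is carried by the theorems, not here.
Nothing is asserted by the definition. [folklore] -/
def PolyClusteringOnBallZd (β p p' ε₀ ε₁ : ℝ) : Prop :=
  ∀ W : Potential (ZdEdge d) (SUN N), MemBallZdP p ε₀ ε₁ W → PerturbedPolyClusteringAt d N β p' W

/-- The ball statement contains the Wilson statement: `PolyClusteringOnBallZd d N β p p′ ε₀ ε₁ → PerturbedPolyClusteringAt d N β p′ 0`
(`0 ≤ ε₀, ε₁`). [folklore] -/
theorem PolyClusteringOnBallZd.wilson {β p p' ε₀ ε₁ : ℝ} (h : PolyClusteringOnBallZd d N β p p' ε₀ ε₁) (h₀ : 0 ≤ ε₀)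
    (h₁ : 0 ≤ ε₁) : PerturbedPolyClusteringAt d N β p' 0 :=
  h 0 (memBallZdP_zero h₀ h₁)

/-- The ball target is monotone in the loads: a statement on larger loads implies the one on smaller loads. [folklore] -/
theorem PolyClusteringOnBallZd.mono {β p p' ε₀ ε₁ ε₀' ε₁' : ℝ} (h : PolyClusteringOnBallZd d N β p p' ε₀ ε₁)
    (h₀ : ε₀' ≤ ε₀) (h₁ : ε₁' ≤ ε₁) : PolyClusteringOnBallZd d N β p p' ε₀' ε₁' :=
  fun W hW => h W (hW.mono h₀ h₁)

end Summit.Ventures.YMGap.RobustBall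

end
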